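import Literature.NumberTheory.EllipticCurves.InertiaReductionAutomorphismProofs
import HarnessLib

/-!
# The Serre–Tate reduced automorphism of a good model IS the reduction of the descent datum
# `C (σC)⁻¹` — the tree's `exists_reducedAut_red_map_eq` with the integral lift EXPORTED
# (cell `b2b-bsdres`, team n1011, seat p07 (gen 8); row T-ROL-ORD FILE F1)

HONEST FRAMING (cell `b2b-bsdres`, run/shared/lean/b2b/bsd-rank1-residual/, verbatim in every
file): the goal of the cell is to DELETE the COMBINATION-SHAPED residual classes of the
Birch–Swinnerton-Dyer formula for ALL analytic-rank `≤ 1` elliptic curves over `ℚ` — "full BSD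
formula for every rank `≤ 1` curve in class `C`" assembled STRICTLY from published theorems — so
that the rank-`≤ 1` remainder becomes exactly the CONSTRUCTION-SHAPED classes, which are TYPED
(missing-input `Prop`s), NOT attempted. This is not "finishing BSD". Team n1011 (N10/N11): research
route on the CONSTRUCTION-SHAPED classes X3♯(G-ord)/X4♯(G-ord); prove what is provable now; no
claim beyond stated classes; census output = EVIDENCE, never a Literature fact; RESIDUAL-MAP marks
UNCHANGED; nothing is booked by this file. TOOL theorems only: NO definition, NO named fact, NO
conjecture node.

## What and why

The tree's `Literature.NumberTheory.EllipticCurves.exists_reducedAut_red_map_eq` (Serre–Tate 1968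
§2 in Weierstrass coordinates): for a good model `W' = C • X_L = W₀ ⊗ L` over the valuation ring
`𝒪_w` of a valued field `(L, w)` and an inertial isometry `σ ∈ Aut(L/F)`, SOME change of variables
`Ã` over the residue field with `Ã • W̃₀ = W̃₀` satisfies `red(Φ(P^σ)) = Ã(red(Φ P))` for every
`P ∈ X(L)`. Its proof builds `Ã` as the reduction of the `𝒪_w`-integral lift `A₀` of the descent
datum `A_σ = C (σC)⁻¹`, but the statement hides this. Row T-ROL-ORD (the EXACT order of the
quotient character of the ramified ordinary line, cc-typer-2's (P-e46-odd) input) needs to READ the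
automorphism: on the Kummer–Deuring model `C = ⟨u, 0, 0, 0⟩ · Cs` (T-ROL-EXP A3) an inertial `σ`
with `σ u = ζ u` has `A_σ = ⟨ζ⁻¹, 0, 0, 0⟩`, so `Ã_σ` is the scaling automorphism `[ζ̄⁻¹]` of
`W̃₀`, which is `1` iff `ζ ≡ 1 (mod 𝔪_w)`.

* §1 `exists_lift_reducedAut_red_map_eq` — the tree theorem re-run WITH THE LIFT EXPORTED:
  `∃ A₀ : VariableChange 𝒪_w, ∃ hÃ : (A₀ mod 𝔪_w) • W̃₀ = W̃₀,
  A₀.map (𝒪_w → L) = C (σC)⁻¹ ∧ ∀ P, red(Φ(P^σ)) = (A₀ mod 𝔪_w)(red(Φ P))`. The proof is the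
  tree's, verbatim (Silverman *AEC* VII.1.3(d) in valuation form for the integrality of `A_σ`,
  VII.2.1 for the reduction of integral points); only the packaging of `A₀` changes.
* §2 `val_coe_u_sub_one_lt_one_of_map_residue_eq_one` — if `A₀ mod 𝔪_w = 1` then the unit `u` of
  `A₀.map (𝒪_w → L)` is `≡ 1 (mod 𝔪_w)`: `w(u − 1) < 1` (reading the `u`-component).

References: J.-P. Serre, J. Tate, Ann. of Math. 88 (1968) §2 Thm. 2 [SerreTate1968]; J. H.
Silverman, *AEC* 2nd ed. VII.1.3(d), VII.2.1 [SilvermanAEC2009]; cells/n1011/skel/T-ROL-ORD.md.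
-/

noncomputable section

open scoped Classical NNReal

open WeierstrassCurve

universe u

namespace Summit.BirchSwinnertonDyer.Rank1Residual.Additive.GoodModelLine

open Literature.NumberTheory.EllipticCurves

/-! ## §1 The reduced automorphism with its integral lift -/

section Core

variable {L : Type u} [Field L] {w : Valuation L ℝ≥0}
  {F : Type*} [Field F] [Algebra F L]

/-- **Inertia acts on the reduction of a good model through the REDUCTION OF THE DESCENT DATUM
`C (σC)⁻¹`.** Let `W' = C • X_L = W₀ ⊗ L` be a `w`-integral model with unit discriminant of the base
change to `L` of a Weierstrass equation `X` over the subfield `F`, the change of variables `C` being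
defined over `L`; let `σ ∈ Aut(L/F)` be an isometry acting trivially on the residue field of `𝒪_w`.
Then `A_σ = C (σC)⁻¹` has a lift `A₀` to `𝒪_w` (it carries the integral unit-discriminant model
`σ(W')` to `W'`, so it is `w`-integral with unit `u`: Silverman *AEC* VII.1.3(d) in valuation form,
`val_le_one_of_smul_eq_of_val_Δ_eq_one`), its reduction `Ã = A₀ mod 𝔪_w` satisfies `Ã • W̃₀ = W̃₀`,
and for every `P ∈ X(L)`, `red(Φ(P^σ)) = Ã(red(Φ(P)))` (`Φ : X(L) ≃ W₀(L)` the substitution,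
`red : W₀(L) → W̃₀(k)` the good-reduction homomorphism). This is the tree's
`exists_reducedAut_red_map_eq` (whose proof constructs exactly this `A₀`) with the lift exported.
[cite: SerreTate1968, §2 Thm. 2 (mechanism of proof)]
[cite: SilvermanAEC2009, VII.1 Prop. 1.3(d) and VII.2 Prop. 2.1] -/
theorem exists_lift_reducedAut_red_map_eq (X : WeierstrassCurve F) (C : VariableChange L)
    {W₀ : WeierstrassCurve w.integer} (hW₀ : C • X.baseChange L = W₀.baseChange L)
    (hΔ : IsUnit W₀.Δ) (σ : L ≃ₐ[F] L) (hσ : ∀ z, w (σ z) = w z)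
    (hσI : ∀ z, w z ≤ 1 → w (σ z - z) < 1) :
    ∃ (A₀ : VariableChange w.integer)
      (hÃ : (A₀.map (IsLocalRing.residue w.integer)) • W₀.map (IsLocalRing.residue w.integer) =
        W₀.map (IsLocalRing.residue w.integer)),
      A₀.map (algebraMap w.integer L) = C * (C.map (σ : L →+* L))⁻¹ ∧
      ∀ P : (X.baseChange L).toAffine.Point,
        goodReductionHom W₀ (Valuation.integer.integers w) hΔ
            (Affine.Point.congrEquiv hW₀ (VariableChange.pointEquiv (X.baseChange L) C
              (Affine.Point.map (σ : L →ₐ[F] L) P))) =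
          Affine.Point.congrEquiv hÃ (VariableChange.pointEquiv _
            (A₀.map (IsLocalRing.residue w.integer))
            (goodReductionHom W₀ (Valuation.integer.integers w) hΔ
              (Affine.Point.congrEquiv hW₀ (VariableChange.pointEquiv (X.baseChange L) C P)))) := by
  have hv0 : w.Integers w.integer := Valuation.integer.integers w
  have hinj : Function.Injective (algebraMap w.integer L) := hv0.hom_inj
  haveI hell : (W₀.map (IsLocalRing.residue w.integer)).IsElliptic := isElliptic_map_residue hΔ
  let O := w.integer
  let k := IsLocalRing.ResidueField w.integer
  set σr : L →+* L := (σ : L →+* L) with hσr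
  -- `σ` restricted to `𝒪_w`, congruent to the identity modulo `𝔪_w`
  have hσO : ∀ x ∈ w.integer, σr x ∈ w.integer := fun x hx ↦ by
    rw [Valuation.mem_integer_iff] at hx ⊢
    rw [hσr]; change w (σ x) ≤ 1; rw [hσ]; exact hx
  set σ₀ : O →+* O := σr.restrict w.integer w.integer hσO with hσ₀
  have hσ₀L : ∀ a : O, algebraMap O L (σ₀ a) = σ (algebraMap O L a) := fun a ↦ rfl
  have hres : ∀ a : O, IsLocalRing.residue O (σ₀ a) = IsLocalRing.residue O a := by
    intro a
    rw [← sub_eq_zero, ← map_sub, IsLocalRing.residue_eq_zero_iff, IsLocalRing.mem_maximalIdeal,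
      mem_nonunits_iff, hv0.isUnit_iff_valuation_eq_one]
    intro h1
    have hlt := hσI (algebraMap O L a) (hv0.map_le_one a)
    rw [← hσ₀L, ← map_sub, h1] at hlt
    exact lt_irrefl _ hlt
  have hresσ : (IsLocalRing.residue O).comp σ₀ = IsLocalRing.residue O := RingHom.ext hres
  -- `σ(W') = A • ...`: the change of variables `A = C (σC)⁻¹`
  set A : VariableChange L := C * (C.map σr)⁻¹ with hA
  have hXσ : (X.baseChange L).map σr = X.baseChange L := X.map_baseChange (σ : L →ₐ[F] L)
  have hVσ : (W₀.baseChange L).map σr = (W₀.map σ₀).baseChange L := by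
    rw [WeierstrassCurve.baseChange, WeierstrassCurve.baseChange, WeierstrassCurve.map_map,
      WeierstrassCurve.map_map]
    congr 1
  have hAW : A • (W₀.map σ₀).baseChange L = W₀.baseChange L := by
    rw [← hVσ, ← hW₀, ← map_variableChange, hXσ, hA, mul_smul, inv_smul_smul]
  -- `A` is integral: lift it to `A₀` over `𝒪_w`
  haveI : ((W₀.map σ₀).baseChange L).IsIntegral O := ⟨W₀.map σ₀, rfl⟩
  haveI : (A • (W₀.map σ₀).baseChange L).IsIntegral O := by rw [hAW]; exact ⟨W₀, rfl⟩
  have hΔL : w (W₀.baseChange L).Δ = 1 := by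
    rw [WeierstrassCurve.baseChange, map_Δ]
    exact (hv0.isUnit_iff_valuation_eq_one).mp hΔ
  have hΔσ : w ((W₀.map σ₀).baseChange L).Δ = 1 := by
    rw [← hVσ, map_Δ, hσr]
    change w (σ (W₀.baseChange L).Δ) = 1
    rw [hσ, hΔL]
  obtain ⟨hu, hr, hs, ht⟩ := val_le_one_of_smul_eq_of_val_Δ_eq_one ((W₀.map σ₀).baseChange L) A
    hΔσ (by rw [hAW]; exact hΔL)
  have huu : IsUnit (⟨(A.u : L), le_of_eq hu⟩ : O) := (hv0.isUnit_iff_valuation_eq_one).mpr hu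
  set A₀ : VariableChange O := ⟨huu.unit, ⟨A.r, hr⟩, ⟨A.s, hs⟩, ⟨A.t, ht⟩⟩ with hA₀
  have hA₀A : A₀.map (algebraMap O L) = A := by
    rw [hA₀]
    ext
    · simp only [VariableChange.map, Units.coe_map, MonoidHom.coe_coe, IsUnit.unit_spec]; rfl
    · rfl
    · rfl
    · rfl
  have hA₀W : A₀ • W₀.map σ₀ = W₀ := by
    apply WeierstrassCurve.map_injective hinj
    change (A₀ • W₀.map σ₀).baseChange L = W₀.baseChange L
    rw [WeierstrassCurve.baseChange, ← map_variableChange, hA₀A]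
    exact hAW
  -- the reduced change of variables
  set Ã : VariableChange k := A₀.map (IsLocalRing.residue O) with hÃdef
  have hÃ : Ã • W₀.map (IsLocalRing.residue O) = W₀.map (IsLocalRing.residue O) := by
    have h' : (A₀ • W₀.map σ₀).map (IsLocalRing.residue O) = W₀.map (IsLocalRing.residue O) := by
      rw [hA₀W]
    rw [← map_variableChange, WeierstrassCurve.map_map, hresσ] at h'
    exact h'
  refine ⟨A₀, hÃ, hA₀A, fun P ↦ ?_⟩
  -- the coordinate identities `C.toX (σ x) = A.toX (σ (C.toX x))` etc.
  have hAC : A * C.map σr = C := by rw [hA, inv_mul_cancel_right]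
  have keyX : ∀ x : L, C.toX (σ x) = A.toX (σ (C.toX x)) := fun x ↦ by
    change C.toX (σr x) = A.toX (σr (C.toX x))
    rw [map_toX_ringHom, ← toX_mul, hAC]
  have keyY : ∀ x y : L, C.toY (σ x) (σ y) = A.toY (σ (C.toX x)) (σ (C.toY x y)) := fun x y ↦ by
    change C.toY (σr x) (σr y) = A.toY (σr (C.toX x)) (σr (C.toY x y))
    rw [map_toX_ringHom, map_toY_ringHom, ← toY_mul, hAC]
  rcases P with _ | ⟨x, y, h⟩
  · simp only [← Affine.Point.zero_def, map_zero]
  -- normalise `P^σ = (σ x, σ y)`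
  have hσns : (X.baseChange L).toAffine.Nonsingular (σ x) (σ y) := by
    have h1 : ((X.baseChange L).map σr).toAffine.Nonsingular (σ x) (σ y) :=
      (Affine.map_nonsingular _ σr.injective x y).mpr h
    rwa [hXσ] at h1
  have hmapP : Affine.Point.map (σ : L →ₐ[F] L) (.some x y h) = .some (σ x) (σ y) hσns := by
    rw [Affine.Point.map_some]
    exact point_some_congr rfl rfl
  rw [hmapP]
  -- `Φ P = (x', y')`
  set x' := C.toX x with hx'
  set y' := C.toY x y with hy'
  rw [VariableChange.pointEquiv_some, VariableChange.pointEquiv_some,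
    Affine.Point.congrEquiv_some, Affine.Point.congrEquiv_some]
  simp only [goodReductionHom_apply]
  have hnsΦ : (W₀.baseChange L).toAffine.Nonsingular x' y' :=
    hW₀ ▸ (VariableChange.nonsingular_iff (X.baseChange L) C x y).mpr h
  have hnsΦσ : (W₀.baseChange L).toAffine.Nonsingular (C.toX (σ x)) (C.toY (σ x) (σ y)) :=
    hW₀ ▸ (VariableChange.nonsingular_iff (X.baseChange L) C (σ x) (σ y)).mpr hσns
  by_cases hxint : w x' ≤ 1
  · -- integral point: both sides reduce to `(Ã x̄', Ã ȳ')`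
    have hyint : w y' ≤ 1 := v_Y_le_one_of_v_X_le_one hv0 (W := W₀) hnsΦ.1 hxint
    obtain ⟨a, ha⟩ := hv0.exists_of_le_one hxint
    obtain ⟨b, hb⟩ := hv0.exists_of_le_one hyint
    have hnsP : (W₀.baseChange L).toAffine.Nonsingular (algebraMap O L a) (algebraMap O L b) := by
      rw [ha, hb]; exact hnsΦ
    have hred₁ : WeierstrassCurve.reducePoint W₀ (.some x' y' hnsΦ) =
        .some (IsLocalRing.residue O a) (IsLocalRing.residue O b)
          ((WeierstrassCurve.hasNonsingularReduction_some_algebraMap_iff hinj hnsP).mp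
            (hasNonsingularReduction_of_isUnit_Δ hv0 hΔ _)) := by
      rw [← WeierstrassCurve.reducePoint_some_algebraMap hinj hnsP]
      congr 1
      exact point_some_congr ha.symm hb.symm
    -- the image point has coordinates `A₀.toX (σ₀ a)`, `A₀.toY (σ₀ a) (σ₀ b)`
    have hX2 : A.toX (σ x') = algebraMap O L (A₀.toX (σ₀ a)) := by
      rw [map_toX_ringHom, hA₀A, hσ₀L, ha]
    have hY2 : A.toY (σ x') (σ y') = algebraMap O L (A₀.toY (σ₀ a) (σ₀ b)) := by
      rw [map_toY_ringHom, hA₀A, hσ₀L, hσ₀L, ha, hb]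
    have hns2 : (W₀.baseChange L).toAffine.Nonsingular (algebraMap O L (A₀.toX (σ₀ a)))
        (algebraMap O L (A₀.toY (σ₀ a) (σ₀ b))) := by
      rw [← hX2, ← hY2, ← keyX, ← keyY]
      exact hnsΦσ
    have hred₂ : WeierstrassCurve.reducePoint W₀ (.some (C.toX (σ x)) (C.toY (σ x) (σ y)) hnsΦσ) =
        .some (IsLocalRing.residue O (A₀.toX (σ₀ a)))
          (IsLocalRing.residue O (A₀.toY (σ₀ a) (σ₀ b)))
          ((WeierstrassCurve.hasNonsingularReduction_some_algebraMap_iff hinj hns2).mp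
            (hasNonsingularReduction_of_isUnit_Δ hv0 hΔ _)) := by
      rw [← WeierstrassCurve.reducePoint_some_algebraMap hinj hns2]
      congr 1
      exact point_some_congr (by rw [keyX, hX2]) (by rw [keyY, hY2])
    have e₁ : WeierstrassCurve.reducePoint W₀ (.some x' y' hnsΦ) =
        WeierstrassCurve.reducePoint W₀ (.some x' y'
          (hW₀ ▸ (VariableChange.nonsingular_iff (X.baseChange L) C x y).mpr h)) := rfl
    have e₂ : WeierstrassCurve.reducePoint W₀ (.some (C.toX (σ x)) (C.toY (σ x) (σ y)) hnsΦσ) =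
        WeierstrassCurve.reducePoint W₀ (.some (C.toX (σ x)) (C.toY (σ x) (σ y))
          (hW₀ ▸ (VariableChange.nonsingular_iff (X.baseChange L) C (σ x) (σ y)).mpr hσns)) := rfl
    rw [← e₂, ← e₁, hred₂, hred₁, VariableChange.pointEquiv_some, Affine.Point.congrEquiv_some]
    refine point_some_congr ?_ ?_
    · rw [map_toX_ringHom, hres]
    · rw [map_toY_ringHom, hres, hres]
  · -- point of the kernel of reduction: both sides are `Õ`
    rw [not_le] at hxint
    have hx1 : x' ∉ Set.range (algebraMap O L) := (not_mem_range_iff hv0).mpr hxint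
    have hx2 : C.toX (σ x) ∉ Set.range (algebraMap O L) := by
      rw [not_mem_range_iff hv0, keyX, VariableChange.toX_def, map_mul, map_pow,
        Units.val_inv_eq_inv_val, map_inv₀, hu, inv_one, one_pow, one_mul]
      have hlt : w A.r < w (σ x') := by rw [hσ]; exact lt_of_le_of_lt hr hxint
      rw [Valuation.map_sub_eq_of_lt_left w hlt, hσ]
      exact hxint
    have e₁ : WeierstrassCurve.reducePoint W₀ (.some x' y'
        (hW₀ ▸ (VariableChange.nonsingular_iff (X.baseChange L) C x y).mpr h)) = 0 :=
      WeierstrassCurve.reducePoint_some_of_not_mem _ hx1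
    have e₂ : WeierstrassCurve.reducePoint W₀ (.some (C.toX (σ x)) (C.toY (σ x) (σ y))
        (hW₀ ▸ (VariableChange.nonsingular_iff (X.baseChange L) C (σ x) (σ y)).mpr hσns)) = 0 :=
      WeierstrassCurve.reducePoint_some_of_not_mem _ hx2
    rw [e₁, e₂, map_zero, map_zero]

/-! ## §2 Reading the unit of the lift -/

/-- **If the reduced automorphism is trivial, the unit of the descent datum is `≡ 1 (mod 𝔪_w)`.**
For a change of variables `A₀` over `𝒪_w` with `A₀ mod 𝔪_w = 1`, the `u`-component of
`A₀ ⊗ L` satisfies `w(u − 1) < 1`. (With §1: if `Ã_σ = 1` then the unit of `C (σC)⁻¹` is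
`≡ 1 (mod 𝔪_w)`.) [folklore] -/
theorem val_coe_u_sub_one_lt_one_of_map_residue_eq_one {A₀ : VariableChange w.integer}
    (h1 : A₀.map (IsLocalRing.residue w.integer) = 1) :
    w ((((A₀.map (algebraMap w.integer L)).u : Lˣ) : L) - 1) < 1 := by
  have hv0 : w.Integers w.integer := Valuation.integer.integers w
  have hu : IsLocalRing.residue w.integer (A₀.u : w.integer) = 1 := by
    have h := congrArg (fun D : VariableChange (IsLocalRing.ResidueField w.integer) ↦ ((D.u :
      (IsLocalRing.ResidueField w.integer)ˣ) : IsLocalRing.ResidueField w.integer)) h1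
    simpa only [VariableChange.map, Units.coe_map, MonoidHom.coe_coe, VariableChange.one_def,
      Units.val_one] using h
  have hmem : (A₀.u : w.integer) - 1 ∈ IsLocalRing.maximalIdeal w.integer := by
    rw [← IsLocalRing.residue_eq_zero_iff, map_sub, hu, map_one, sub_self]
  rw [IsLocalRing.mem_maximalIdeal, mem_nonunits_iff, hv0.isUnit_iff_valuation_eq_one] at hmem
  have hle : w (algebraMap w.integer L ((A₀.u : w.integer) - 1)) ≤ 1 := hv0.map_le_one _
  have hcoe : (((A₀.map (algebraMap w.integer L)).u : Lˣ) : L) - 1 =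
      algebraMap w.integer L ((A₀.u : w.integer) - 1) := by
    simp only [VariableChange.map, Units.coe_map, MonoidHom.coe_coe, map_sub, map_one]
  rw [hcoe]
  exact lt_of_le_of_ne hle hmem

end Core

end Summit.BirchSwinnertonDyer.Rank1Residual.Additive.GoodModelLine

end
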